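import Literature.MathematicalPhysics.QuantumLattice.LTQO
import Literature.MathematicalPhysics.QuantumLattice.LatticeToriProofs
import HarnessLib

/-!
# Torus geometry for the Michalakis–Zwolak decomposition: half-side balls and ball counting

Top-down layer (seat B) of the formalisation of the Michalakis–Zwolak stability theorem
(hubbard.S19, `Literature.MathematicalPhysics.QuantumLattice.michalakis_zwolak`), companion of
`StabilityLocalDecompositionProofs`. Two pieces of lattice bookkeeping on the decorated torus
`(ℤ/Lℤ)^d × κ` with the balls `cellBall x r = torusBall x r ×ˢ univ` of `LTQO.lean`:

* the periodic sup-distance is at most `L / 2` (`torusDist_le_half`), so every ball of radius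
  `≥ L / 2` is the whole torus (`cellBall_eq_univ_of_half_le`): in the chain of local ground-state
  projections `P_{b_u(j)}` all layers `P_{b_u(j)} − P_{b_u(j+1)}` with `2j ≥ L` vanish, and the
  non-trivial layers all lie in the non-wrapping range `2j < L` of `HasLTQO`;
* **ball counting**: `#{u | torusDist u y ≤ r} ≤ (2r + 1)^d` (`card_filter_torusDist_le_le`,
  coordinatewise via `card_filter_cyclicAbs_le_le` of `LatticeToriProofs`), hence a nonempty
  region `Z` lies in at most `(2r + 1)^d` balls `cellBall u r` (`card_filter_subset_cellBall_le`)
  — the multiplicity `C_d r^d` ("the number of balls of radius `r` containing `b_u(1)`") in the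
  counting step of MZ13 Proposition 2 (arXiv:1109.1588 p. 14, display (bnd:color)).

No definitions, no named facts (theorems only).
-/

noncomputable section

open Finset

namespace Literature.MathematicalPhysics.QuantumLattice

open Literature.Probability.LatticeModels

section Half

variable {d L : ℕ} [NeZero L]

/-- The cyclic absolute value on `ZMod L` is at most `L / 2` (`min (v, L − v) ≤ (v + (L − v))/2`).
[folklore] -/
theorem cyclicAbs_le_half (z : ZMod L) : min z.val (L - z.val) ≤ L / 2 := by
  have hz : z.val < L := ZMod.val_lt z
  rcases le_total z.val (L - z.val) with h | h
  · rw [min_eq_left h]; omega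
  · rw [min_eq_right h]; omega

/-- **The torus distance is at most half the side**, `torusDist x y ≤ L / 2` on `(ℤ/Lℤ)^d`.
(Friedli–Velenik 2017, §3.1.) [folklore] -/
theorem torusDist_le_half (x y : TorusSite d L) : torusDist x y ≤ L / 2 := by
  unfold torusDist
  simp only [torusNorm]
  exact Finset.sup_le fun i _ => cyclicAbs_le_half _

variable {κ : Type*} [Fintype κ]

/-- **Balls of radius `≥ L / 2` are the whole decorated torus.** [folklore] -/
theorem cellBall_eq_univ_of_half_le (x : TorusSite d L) {j : ℕ} (h : L / 2 ≤ j) :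
    (cellBall x j : Finset (TorusSite d L × κ)) = univ := by
  ext y
  simp only [mem_cellBall_iff, mem_univ, iff_true]
  exact (torusDist_le_half x y.1).trans h

/-- Balls with `2j ≥ L` are the whole decorated torus (`L / 2 ≤ j`). [folklore] -/
theorem cellBall_eq_univ_of_le_two_mul (x : TorusSite d L) {j : ℕ} (h : L ≤ 2 * j) :
    (cellBall x j : Finset (TorusSite d L × κ)) = univ :=
  cellBall_eq_univ_of_half_le x (by omega)

omit [NeZero L] in
/-- If `2q < L` then `2 (q + ((L − 1)/2 − q)) < L`: the radius `ℓ = (L − 1)/2 − q` is admissible in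
`HasLTQO` for an observable supported in a ball of radius `q`. [folklore] -/
theorem two_mul_add_half_pred_sub_lt {q : ℕ} (h : 2 * q < L) : 2 * (q + ((L - 1) / 2 - q)) < L := by
  omega

end Half

/-! ### Ball counting -/

section Counting

variable {d L : ℕ} [NeZero L]

/-- **Ball counting on the cubic torus** `(ℤ/Lℤ)^d`: the closed ball `{u | torusDist u y ≤ r}` has
at most `(2r + 1)^d` sites (each coordinate of `u − y` has cyclic absolute value `≤ r`, at most
`2r + 1` choices, `card_filter_cyclicAbs_le_le`). [folklore] -/
theorem card_filter_torusDist_le_le (y : TorusSite d L) (r : ℕ) :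
    (univ.filter fun u : TorusSite d L => torusDist u y ≤ r).card ≤ (2 * r + 1) ^ d := by
  classical
  set B : Finset (ZMod L) := univ.filter fun z : ZMod L => min z.val (L - z.val) ≤ r with hB
  have hBc : B.card ≤ 2 * r + 1 := card_filter_cyclicAbs_le_le r
  have hsub : ∀ u ∈ (univ.filter fun u : TorusSite d L => torusDist u y ≤ r),
      (u - y) ∈ Fintype.piFinset (fun _ : Fin d => B) := by
    intro u hu
    simp only [mem_filter, mem_univ, true_and] at hu
    unfold torusDist at hu
    simp only [torusNorm] at hu
    rw [Fintype.mem_piFinset]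
    intro i
    simp only [hB, mem_filter, mem_univ, true_and]
    exact (Finset.le_sup (f := fun i => min ((u - y) i).val (L - ((u - y) i).val))
      (mem_univ i)).trans hu
  calc (univ.filter fun u : TorusSite d L => torusDist u y ≤ r).card
      ≤ (Fintype.piFinset (fun _ : Fin d => B)).card := by
        refine Finset.card_le_card_of_injOn (fun u => u - y) hsub ?_
        intro u _ v _ h
        simpa using h
    _ = ∏ _i : Fin d, B.card := Fintype.card_piFinset _
    _ ≤ ∏ _i : Fin d, (2 * r + 1) := Finset.prod_le_prod' fun i _ => hBc
    _ = (2 * r + 1) ^ d := by rw [prod_const, card_univ, Fintype.card_fin]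

variable {κ : Type*} [Fintype κ] [DecidableEq κ]

/-- **A nonempty region lies in at most `(2r + 1)^d` balls of radius `r`**: if `z ∈ Z` then
`Z ⊆ cellBall u r` forces `torusDist u z.1 ≤ r`. This is the multiplicity bound in the counting
step `Σ_j H_j(r) ≤ C_d r^d H₀` of MZ13 Proposition 2 (arXiv:1109.1588 p. 14: "the number of balls
of radius `r` containing `b_u(1)` … which is exactly equal to `C_d r^d`").
[cite: MichalakisZwolakCMP2013, §6 proof of Prop. 2 (arXiv:1109.1588 p. 14)] -/
theorem card_filter_subset_cellBall_le {Z : Finset (TorusSite d L × κ)} (hZ : Z.Nonempty)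
    (r : ℕ) :
    (univ.filter fun u : TorusSite d L => Z ⊆ (cellBall u r : Finset (TorusSite d L × κ))).card ≤
      (2 * r + 1) ^ d := by
  obtain ⟨z, hz⟩ := hZ
  refine (card_le_card ?_).trans (card_filter_torusDist_le_le z.1 r)
  intro u hu
  simp only [mem_filter, mem_univ, true_and] at hu ⊢
  exact mem_cellBall_iff.1 (hu hz)

/-- Variant of `card_filter_subset_cellBall_le` for a family of centres restricted to a subset
`S` of the Bravais sites. [cite: MichalakisZwolakCMP2013, §6 proof of Prop. 2 (arXiv:1109.1588 p. 14)] -/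
theorem card_filter_subset_cellBall_le' (S : Finset (TorusSite d L))
    {Z : Finset (TorusSite d L × κ)} (hZ : Z.Nonempty) (r : ℕ) :
    (S.filter fun u : TorusSite d L => Z ⊆ (cellBall u r : Finset (TorusSite d L × κ))).card ≤
      (2 * r + 1) ^ d :=
  (card_le_card (filter_subset_filter _ (subset_univ S))).trans (card_filter_subset_cellBall_le hZ r)

end Counting

end Literature.MathematicalPhysics.QuantumLattice
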